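import Literature.MathematicalPhysics.QuantumFieldTheory.Balaban1983to89.T4LimitDensity
import Literature.MathematicalPhysics.QuantumFieldTheory.Balaban1983to89.T4Continuum
import Literature.MathematicalPhysics.QuantumFieldTheory.Balaban1983to89.T4GenFunBounds
import Literature.MathematicalPhysics.QuantumFieldTheory.Balaban1983to89.T4ReflectionCone

/-!
# `Balaban1983to89.T4LimitDensityT4` — the binding of `T4LimitDensity` to the four-torus family: ONE unit-lattice
# configuration space `X = G^{unit bonds}`, the laws of the averaged fields `V_K` transported to it, and node E4's
# hypotheses / conclusions restated for `FiniteEpsData` (cell `pub-balaban`, `t4/T4-DAG.md` node E4, row T4-E4.B)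

CITATION HEADER (lean-in-tree rule 2026-08-18).  Sources of the QUOTATIONS in this file (nothing else of the series is
used, reproduced or asserted; both quotations are those of the sibling module `…Balaban1983to89.T4LimitDensity`, whose
hypotheses this file merely instantiates):
* T. Bałaban, *Convergent renormalization expansions for lattice gauge theories*, Commun. Math. Phys. **119** (1988)
  243–285 [Balaban1988Convergent] (cell paper B14 = [III]), p. 264, read from the page render exactly as transcribed in
  the sibling module `…Balaban1983to89.B14Cor3` (header (a)): *"Corollary 3. (Ultraviolet Stability). Under the
  assumptions of Theorem 1 there exist constants E₋, E₊ independent of η and T, but depending on g_k, such that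
  χ_k(T_η) exp[−(1/g_k²) A(U_k(V_k)) − E₋|T_η|] ≤ ρ_k(V_k) ≤ e^{E₊|T_η|}. (2.50)"*.
* J. Magnen, V. Rivasseau, R. Sénéor, Commun. Math. Phys. **155** (1993) [MagnenRivasseauSeneor1993] pp. 325–326 (as
  quoted in `…Balaban1983to89.Missing`): the continuum limit is obtained *"at least through a compactness argument
  using a subsequence of approximations; but the limit is not necessarily unique"*.

WHAT THIS FILE DOES (kernel; Mathlib measure theory and the tree's own vocabulary; every theorem elementary, tagged
[folklore], sorry-free).  `T4LimitDensity` is stated over ABSTRACT data: a pseudo-metrisable Borel space `X`, a finite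
reference measure `ν` and laws `law : ℕ → Measure X` — because the tree's `GaugeField` carries no topology and the unit
lattice `T^{(K)}_1` of the `K`-th approximation is a `K`-DEPENDENT type `GaugeField (F.P K) K G`.  Here the data are
CONSTRUCTED for the four-torus family `F : T4Family` of `…T4Continuum` and finite-ε data `D : FiniteEpsData F G`:
§1 `UBond F := PBond (F.P 0) 0` — the positively oriented bonds of the unit torus `T₁` (`2L^m` sites per direction,
   `T4Family.sitesPerDir_top`), realised, as the tree's `T4Family.USite`, at `K = 0` —, `UCfg F G := UBond F → G` — THE fixed configuration space `X = G^{UBond}` with the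
   PRODUCT topology / Borel structure (compact, Hausdorff, second countable, metrisable as soon as `G` is) —,
   `unitHaar F G` = product Haar measure on it (a probability measure); the explicit equivalences `bondEquiv F K :
   UBond F ≃ PBond (F.P K) K` (coordinatewise `T4Family.siteEquiv`, i.e. `toLevel`) and `cfgEquiv F G K :
   GaugeField (F.P K) K G ≃ᵐ UCfg F G` (pull-back along `bondEquiv`), with `map_fieldMeasure_cfgEquiv`: the product Haar
   measure `dV` of `T^{(K)}_1` is transported to `unitHaar` for EVERY `K` (so one reference measure serves all `K`);
   `walk_toLevel` (from the tree's `T4ReflectionCone.toLevel_shift` / `toLevel_unshift`) / `holAt_cfgEquiv` /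
   `loopAt_cfgEquiv_walk`: lattice walks and holonomies commute with the transport, whence `avgObs_eq_unitObs`: the unit-scale averaged loop variable of a label
   `C : ULoop F` at step `K` IS the `K`-INDEPENDENT function `unitObs F G C : UCfg F G → ℝ` evaluated at the transported
   averaged field; `unitObs` is measurable, bounded by `1`, and continuous when `Re tr` and the group operations are.
§2 `topLaw D g₀ K` = the law of `V_K = (K-fold average of U)`, `U` distributed by the Wilson Gibbs measure
   `T4GenFunBounds.gibbsMeasure (F.P K) ((g₀ K)⁻²)` of the scheme `D.scheme g₀` (push-forward under `Averaging.iter`;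
   a probability measure under the tree's hypothesis `FiniteEpsData.AvgMeasurable` — for a non-measurable averaging
   Mathlib's `Measure.map` would return the junk value `0`),
   `unitLaw D g₀ K` = its transport to `X`, `unitLawP` = the same as a `ProbabilityMeasure`; THE DICTIONARY
   `expectAt_eq_integral_unitLaw`: the finite-ε joint expectations of the class ARE integrals of the fixed functions
   `unitObsProd F G Cs` against `unitLaw D g₀ K`; hence (`isLimitFunctional_of_tendsto_unitLaw`) EVERY weak limit point
   `μ` of the laws along a subsequence `φ` is a limit functional of the scheme in the tree's sense
   (`Missing.IsLimitFunctional (fun n => (D.scheme g₀).expectAt (φ n)) (fun Cs => ∫ unitObsProd Cs dμ)`), and such limit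
   points exist (`exists_subseq_tendsto_unitLawP`, compactness of `ProbabilityMeasure X` — the measure-level form of
   the MRS sentence; the tree's hypothesis-free `T4Continuum.avg_hasSubseqContinuumLimit` is recovered as
   `hasSubseqContinuumLimit_of_laws`, under `AvgMeasurable` and continuity).
§3 NODE E4 FOR `FiniteEpsData`: the named hypotheses `E4UpperT4 D g₀ := E4Upper (unitHaar F G) (unitLaw D g₀)`,
   `E4LowerT4`, `E4HypT4` (NOT printed statements, NOT asserted — see LOCATED STATUS), their LEVELWISE readings
   `e4UpperT4_iff` / `e4LowerT4_iff` (`∃ E, ∀ K, topLaw D g₀ K ≤ e^{E} · dV` on `T^{(K)}_1` itself, resp. `e^{-E} dV ≤`;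
   `topLaw_le_of_density_le`: implied by an a.e. bound `≤ e^{E}` on any push-forward density), and the instantiated
   conclusions: E4a `limit_le_of_e4UpperT4` (every weak limit point `μ ≤ e^{E} unitHaar`, `μ ≪ unitHaar`,
   `dμ/d unitHaar ≤ e^{E}` a.e.) and `exists_limitFunctional_ac_of_e4UpperT4`; E4b `le_limit_of_e4LowerT4`; two-sided
   `exists_haarEquivalent_limit_of_e4HypT4` (= `E4Hyp.exists_limit`) and `exists_limitFunctional_of_e4HypT4` (a limit
   functional of the class represented by a measure EQUIVALENT to product Haar with a two-sided density window).
   LOCATED STATUS (as in `T4LimitDensity` §3, nothing added): the upper half of (2.50) is printed for the effective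
   densities `ρ_k` of [Balaban1988Convergent] §2, not for the push-forward laws `topLaw` (whose relation to `ρ_k` past
   the first step involves the operation `R` of the series — the cell's T4-DAG §2 O3a / O3-alt, §7 Q6); `E4UpperT4` is
   therefore a HYPOTHESIS located at B14 p. 264 + a reading; the lower half of (2.50) is V-dependent (small-field
   characteristic function and background action) and its derivation is not printed in d = 4 (cell GAPS.md G-adv3-2),
   so the uniform `E4LowerT4` is STRONGER IN SHAPE than print and is carried as a hypothesis only.  Which limit point —
   uniqueness — is untouched (MRS p. 326; tree `Missing.HasUniqueLimitPoints`, the cell's U-spine).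
§4 A sanity `example`: for `G = SU(N)` (`Matrix.specialUnitaryGroup (Fin N) ℂ`, the tree's `UnitaryModel` instances)
   every instance hypothesis of §§2–3 is available and `Re tr` is continuous.
WHAT IS *NOT* HERE: no statement of the series is asserted; no claim that `E4UpperT4` / `E4LowerT4` hold; no density
for `topLaw` is constructed or identified with any `ρ_k`; nothing about uniqueness.  Value = kernel measure theory +
a typed dictionary + located hypotheses, NOT summit progress.  Unit `b2b-balaban-pv14` (surge node prover #14, gen 4);
companion cell rows: CLAIMS.log T4-E4.B, GAPS.md C-pv14-32.
-/

namespace Literature.MathematicalPhysics.QuantumFieldTheory.Balaban1983to89.T4LimitDensityT4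

open _root_.MeasureTheory Filter Set
open scoped Topology ENNReal NNReal BoundedContinuousFunction BigOperators
open T4Continuum T4LimitDensity T4GenFunBounds Missing

/-! ## 1. The fixed unit-lattice configuration space `X = G^{UBond}` and the transport of each `T^{(K)}_1` to it -/

section UnitLattice

variable (F : T4Family)

/-- The positively oriented bonds of the unit torus `T₁`, realised at `K = 0` (the tree's `T4Family.USite` convention,
DIVERGENCE D-t4l.2 of `T4Continuum`). [folklore] -/
abbrev UBond : Type := PBond (F.P 0) 0

/-- THE TRANSPORT OF BONDS: a bond `⟨x, μ⟩` of `T₁` is the bond `⟨toLevel K x, μ⟩` of the top level `T^{(K)}_1` of the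
`K`-th approximation (same modulus `2L^m`, `T4Family.sitesPerDir_top`); an equivalence, inverse coordinatewise
`(siteEquiv K).symm`. [folklore] -/
def bondEquiv (K : ℕ) : UBond F ≃ PBond (F.P K) K where
  toFun b := ⟨F.toLevel K b.src, b.dir⟩
  invFun c := ⟨fun ν => (F.siteEquiv K).symm (c.src ν), c.dir⟩
  left_inv := fun ⟨x, μ⟩ => by
    simp only [PBond.mk.injEq, and_true]
    funext ν
    simp [T4Family.toLevel]
  right_inv := fun ⟨y, μ⟩ => by
    simp only [PBond.mk.injEq, and_true]
    funext ν
    simp [T4Family.toLevel]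

/-- The transported bond starts at the transported site. [folklore] -/
@[simp] theorem bondEquiv_apply_src (K : ℕ) (b : UBond F) : (bondEquiv F K b).src = F.toLevel K b.src := rfl

/-- The transported bond has the same direction. [folklore] -/
@[simp] theorem bondEquiv_apply_dir (K : ℕ) (b : UBond F) : (bondEquiv F K b).dir = b.dir := rfl

/-- Transport of oriented steps (bond + orientation) of `T₁` to `T^{(K)}_1`. [folklore] -/
def stepUp (K : ℕ) (s : LStep (F.P 0) 0) : LStep (F.P K) K := ⟨bondEquiv F K s.bond, s.fwd⟩

/-- THE WALK OF A WORD COMMUTES WITH THE TRANSPORT: the walk spelled by `w` from `toLevel K x` in `T^{(K)}_1` is the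
transported walk spelled by `w` from `x` in `T₁` (by the tree's `T4ReflectionCone.toLevel_shift` / `toLevel_unshift`:
`toLevel` commutes with the unit steps). [folklore] -/
theorem walk_toLevel (K : ℕ) :
    ∀ (x : F.USite) (w : List (Letter 4)), walk (F.toLevel K x) w = (walk x w).map (stepUp F K)
  | _, [] => rfl
  | x, (μ, true) :: w => by
    simp only [List.map_cons, walk]
    rw [← T4ReflectionCone.toLevel_shift, walk_toLevel K (x.shift μ) w]
    rfl
  | x, (μ, false) :: w => by
    simp only [List.map_cons, walk]
    rw [← T4ReflectionCone.toLevel_unshift, walk_toLevel K (x.unshift μ) w]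
    rfl

variable (G : Type*) [GaugeGroup G] [MeasurableSpace G] [HaarData G]

/-- THE FIXED UNIT-LATTICE CONFIGURATION SPACE `X = G^{UBond}`: one group element per bond of `T₁`, as a plain
product type — so that Mathlib's product topology, product Borel structure, compactness (`Pi.compactSpace`),
metrisability and `BorelSpace` instances apply verbatim.  It is DEFINITIONALLY the tree's `GaugeField (F.P 0) 0 G`
(`unitEquiv`). [folklore] -/
abbrev UCfg : Type _ := UBond F → G

/-- `X` is literally the type of gauge fields on `T₁ = T^{(0)}` of the `0`-th approximation: the identity as a measurable
equivalence (the tree's measurable structure on `GaugeField` is the product structure). [folklore] -/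
def unitEquiv : GaugeField (F.P 0) 0 G ≃ᵐ UCfg F G where
  toFun U := U
  invFun W := W
  left_inv _ := rfl
  right_inv _ := rfl
  measurable_toFun := fun _ hs => hs
  measurable_invFun := fun _ hs => hs

/-- THE REFERENCE MEASURE `ν`: product Haar measure on `X`. [folklore] -/
noncomputable def unitHaar : Measure (UCfg F G) := Measure.pi fun _ : UBond F => (HaarData.haar : Measure G)

/-- Product Haar measure on `X` is a probability measure. [folklore] -/
instance isProbabilityMeasure_unitHaar : IsProbabilityMeasure (unitHaar F G) := by
  haveI : IsProbabilityMeasure (HaarData.haar (G := G)) := HaarData.isProb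
  exact Measure.pi.instIsProbabilityMeasure _

/-- `ν` is the tree's `fieldMeasure` of `T^{(0)}` of the `0`-th approximation, transported by the identity. [folklore] -/
theorem unitHaar_eq_fieldMeasure : unitHaar F G = (fieldMeasure (F.P 0) 0 G).map (unitEquiv F G) := by
  ext s hs
  rw [MeasurableEquiv.map_apply]
  rfl

/-- THE TRANSPORT OF CONFIGURATIONS: a gauge field `V` on `T^{(K)}_1` is the configuration `b ↦ V(bondEquiv K b)` on
`X`; a measurable equivalence (both directions are coordinate maps). [folklore] -/
def cfgEquiv (K : ℕ) : GaugeField (F.P K) K G ≃ᵐ UCfg F G where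
  toFun V b := V (bondEquiv F K b)
  invFun W c := W ((bondEquiv F K).symm c)
  left_inv V := funext fun c => by simp only [Equiv.apply_symm_apply]
  right_inv W := funext fun b => by simp only [Equiv.symm_apply_apply]
  measurable_toFun := measurable_pi_lambda _ fun b => Missing.measurable_eval (G := G) (bondEquiv F K b)
  measurable_invFun := measurable_pi_lambda _ fun c => measurable_pi_apply ((bondEquiv F K).symm c)

omit [GaugeGroup G] [HaarData G] in
/-- `cfgEquiv K V b = V (bondEquiv K b)`. [folklore] -/
@[simp] theorem cfgEquiv_apply (K : ℕ) (V : GaugeField (F.P K) K G) (b : UBond F) :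
    cfgEquiv F G K V b = V (bondEquiv F K b) := rfl

omit [GaugeGroup G] [HaarData G] in
/-- `(cfgEquiv K)⁻¹ W c = W ((bondEquiv K)⁻¹ c)`. [folklore] -/
@[simp] theorem cfgEquiv_symm_apply (K : ℕ) (W : UCfg F G) (c : PBond (F.P K) K) :
    (cfgEquiv F G K).symm W c = W ((bondEquiv F K).symm c) := rfl

/-- ONE REFERENCE MEASURE FOR ALL `K`: the product Haar measure `dV = ∏_b dV(b)` of `T^{(K)}_1` (tree `fieldMeasure`) is
transported by `cfgEquiv K` to the product Haar measure of `X` — a bijection of the index sets carries a product of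
copies of one measure to the product. [folklore] -/
theorem map_fieldMeasure_cfgEquiv (K : ℕ) : (fieldMeasure (F.P K) K G).map (cfgEquiv F G K) = unitHaar F G := by
  haveI : IsProbabilityMeasure (HaarData.haar (G := G)) := HaarData.isProb
  symm
  refine Measure.pi_eq fun s _ => ?_
  rw [MeasurableEquiv.map_apply]
  have hpre : (cfgEquiv F G K) ⁻¹' Set.pi Set.univ s =
      Set.pi Set.univ fun c => s ((bondEquiv F K).symm c) := by
    ext V
    simp only [Set.mem_preimage, Set.mem_univ_pi]
    constructor
    · intro h c
      simpa using h ((bondEquiv F K).symm c)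
    · intro h b
      simpa using h (bondEquiv F K b)
  rw [hpre]
  exact (Measure.pi_pi (fun _ : PBond (F.P K) K => (HaarData.haar : Measure G))
      (fun c => s ((bondEquiv F K).symm c))).trans
    ((bondEquiv F K).symm.prod_comp fun b => (HaarData.haar : Measure G) (s b))

/-- Monotonicity of push-forwards along a measurable equivalence is an equivalence. [folklore] -/
theorem map_le_map_iff {α β : Type*} [MeasurableSpace α] [MeasurableSpace β] (e : α ≃ᵐ β) {μ κ : Measure α} :
    μ.map e ≤ κ.map e ↔ μ ≤ κ :=
  ⟨fun h => by simpa only [MeasurableEquiv.map_symm_map] using Measure.map_mono h e.symm.measurable,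
    fun h => Measure.map_mono h e.measurable⟩

/-! ### Loop variables on `X` and their transport -/

omit [HaarData G] in
/-- Holonomy of the transported configuration along steps of `T₁` = holonomy of the original along the transported
steps. [folklore] -/
theorem holAt_cfgEquiv (K : ℕ) (V : GaugeField (F.P K) K G) (γ : List (LStep (F.P 0) 0)) :
    holAt (P := F.P 0) (j := 0) (cfgEquiv F G K V) γ = holAt V (γ.map (stepUp F K)) := by
  simp only [holAt, List.map_map]
  rfl

omit [HaarData G] in
/-- Loop variable of the transported configuration along the walk of `w` from `x` in `T₁` = loop variable of the
original along the walk of `w` from `toLevel K x` in `T^{(K)}_1`. [folklore] -/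
theorem loopAt_cfgEquiv_walk (K : ℕ) (V : GaugeField (F.P K) K G) (x : F.USite) (w : List (Letter 4)) :
    loopAt (P := F.P 0) (j := 0) (cfgEquiv F G K V) (walk x w) = loopAt V (walk (F.toLevel K x) w) := by
  rw [loopAt, loopAt, holAt_cfgEquiv, walk_toLevel]

/-- THE LOOP VARIABLE OF A LABEL AS A FIXED FUNCTION ON `X`: `W ↦ Re tr 𝒲(C)/N` along the walk of the based closed
word `C` in `T₁` (the tree's `loopAt` at level `0` of the `0`-th approximation). [folklore] -/
def unitObs (C : ULoop F) (W : UCfg F G) : ℝ := loopAt (P := F.P 0) (j := 0) (G := G) W (walk C.1.base C.1.word)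

/-- The product of the loop variables of a string of labels, as a fixed function on `X`. [folklore] -/
def unitObsProd (Cs : List (ULoop F)) (W : UCfg F G) : ℝ := (Cs.map fun C => unitObs F G C W).prod

omit [MeasurableSpace G] [HaarData G] in
/-- The empty product of loop variables is `1`. [folklore] -/
@[simp] theorem unitObsProd_nil (W : UCfg F G) : unitObsProd F G [] W = 1 := by simp [unitObsProd]

omit [MeasurableSpace G] [HaarData G] in
/-- `unitObsProd (C :: Cs) = unitObs C · unitObsProd Cs`. [folklore] -/
@[simp] theorem unitObsProd_cons (C : ULoop F) (Cs : List (ULoop F)) (W : UCfg F G) :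
    unitObsProd F G (C :: Cs) W = unitObs F G C W * unitObsProd F G Cs W := by simp [unitObsProd]

/-- **THE AVERAGED LOOP VARIABLE IS THE TRANSPORTED FIXED OBSERVABLE**: `avgObs_K(C)(U) = unitObs C (cfgEquiv K (avg^K U))`
— the `K`-dependence of the tree's `FiniteEpsData.avgObs` sits entirely in the averaged field, not in the function on
`X`. [folklore] -/
theorem avgObs_eq_unitObs (D : FiniteEpsData F G) (K : ℕ) (C : ULoop F) (U : GaugeField (F.P K) 0 G) :
    D.avgObs K C U = unitObs F G C (cfgEquiv F G K (Averaging.iter (D.av K) K U)) := by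
  rw [unitObs, loopAt_cfgEquiv_walk]
  rfl

variable [RegularGaugeGroup G]

omit [HaarData G] in
/-- Loop variables on `X` are measurable (`Re tr`, multiplication and inversion measurable). [folklore] -/
theorem measurable_unitObs (C : ULoop F) : Measurable (unitObs F G C) :=
  measurable_loopAt (P := F.P 0) (j := 0) (G := G) _

omit [HaarData G] in
/-- `|unitObs C W| ≤ 1`. [folklore] -/
theorem abs_unitObs_le_one (C : ULoop F) (W : UCfg F G) : |unitObs F G C W| ≤ 1 :=
  abs_loopAt_le_one (P := F.P 0) (j := 0) (G := G) _ _

omit [HaarData G] in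
/-- Products of loop variables on `X` are measurable. [folklore] -/
theorem measurable_unitObsProd : ∀ Cs : List (ULoop F), Measurable (unitObsProd F G Cs)
  | [] => by
    have h : unitObsProd F G [] = fun _ => 1 := funext fun W => unitObsProd_nil F G W
    rw [h]
    exact measurable_const
  | C :: Cs => by
    have h : unitObsProd F G (C :: Cs) = fun W => unitObs F G C W * unitObsProd F G Cs W :=
      funext fun W => unitObsProd_cons F G C Cs W
    rw [h]
    exact (measurable_unitObs F G C).mul (measurable_unitObsProd Cs)

omit [HaarData G] in
/-- `|unitObsProd Cs W| ≤ 1`. [folklore] -/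
theorem abs_unitObsProd_le_one : ∀ (Cs : List (ULoop F)) (W : UCfg F G), |unitObsProd F G Cs W| ≤ 1
  | [], W => by simp
  | C :: Cs, W => by
    rw [unitObsProd_cons, abs_mul]
    calc |unitObs F G C W| * |unitObsProd F G Cs W| ≤ 1 * 1 :=
          mul_le_mul (abs_unitObs_le_one F G C W) (abs_unitObsProd_le_one Cs W) (abs_nonneg _) zero_le_one
      _ = 1 := one_mul 1

omit [MeasurableSpace G] [HaarData G] [RegularGaugeGroup G] in
/-- Holonomies along steps of `T₁` are continuous functions on `X` (continuous group operations). [folklore] -/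
theorem continuous_holAt_unit [TopologicalSpace G] [ContinuousMul G] [ContinuousInv G] :
    ∀ γ : List (LStep (F.P 0) 0), Continuous fun W : UCfg F G => holAt (P := F.P 0) (j := 0) (G := G) W γ
  | [] => by
    simp only [holAt, List.map_nil, List.prod_nil]
    exact continuous_const
  | s :: γ => by
    have hs : Continuous fun W : UCfg F G => if s.fwd then W s.bond else (W s.bond)⁻¹ := by
      obtain ⟨b, f⟩ := s
      cases f
      · simp only [Bool.false_eq_true, ↓reduceIte]
        exact (continuous_apply b).inv
      · simp only [↓reduceIte]
        exact continuous_apply b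
    have h : (fun W : UCfg F G => holAt (P := F.P 0) (j := 0) (G := G) W (s :: γ)) =
        fun W => (if s.fwd then W s.bond else (W s.bond)⁻¹) * holAt (P := F.P 0) (j := 0) (G := G) W γ := by
      funext W
      simp only [holAt, List.map_cons, List.prod_cons]
    rw [h]
    exact hs.mul (continuous_holAt_unit γ)

omit [MeasurableSpace G] [HaarData G] [RegularGaugeGroup G] in
/-- Loop variables on `X` are continuous when `Re tr` and the group operations are (true for closed subgroups of
`U(N)`, §4). [folklore] -/
theorem continuous_unitObs [TopologicalSpace G] [ContinuousMul G] [ContinuousInv G]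
    (hc : Continuous (reTr : G → ℝ)) (C : ULoop F) : Continuous (unitObs F G C) :=
  hc.comp (continuous_holAt_unit F G _)

omit [MeasurableSpace G] [HaarData G] [RegularGaugeGroup G] in
/-- Products of loop variables on `X` are continuous (same hypotheses). [folklore] -/
theorem continuous_unitObsProd [TopologicalSpace G] [ContinuousMul G] [ContinuousInv G]
    (hc : Continuous (reTr : G → ℝ)) : ∀ Cs : List (ULoop F), Continuous (unitObsProd F G Cs)
  | [] => by
    have h : unitObsProd F G [] = fun _ => 1 := funext fun W => unitObsProd_nil F G W
    rw [h]
    exact continuous_const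
  | C :: Cs => by
    have h : unitObsProd F G (C :: Cs) = fun W => unitObs F G C W * unitObsProd F G Cs W :=
      funext fun W => unitObsProd_cons F G C Cs W
    rw [h]
    exact (continuous_unitObs F G hc C).mul (continuous_unitObsProd hc Cs)

end UnitLattice

/-! ## 2. The laws of the averaged fields `V_K`, transported to `X`; the dictionary with the scheme's expectations -/

section Laws

variable {F : T4Family} {G : Type*} [GaugeGroup G] [MeasurableSpace G] [HaarData G] [RegularGaugeGroup G]
  (D : FiniteEpsData F G) (g₀ : ℕ → ℝ)

omit [RegularGaugeGroup G] in
/-- The scheme's `K`-th lattice is `F.P K` and its inverse coupling is `β_K = (g₀ K)⁻²` (definitionally). [folklore] -/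
theorem scheme_expectAt (K : ℕ) (Cs : List (ULoop F)) :
    (D.scheme g₀).expectAt K Cs =
      Missing.expect (F.P K) ((g₀ K)⁻¹ ^ 2) fun U => (Cs.map fun C => D.avgObs K C U).prod := rfl

/-- THE LAW OF `V_K` ON `T^{(K)}_1`: the push-forward of the Wilson Gibbs measure of the `K`-th lattice at `β_K =
(g₀ K)⁻²` (tree `T4GenFunBounds.gibbsMeasure`) under the `K`-fold averaging `Averaging.iter (D.av K) K :
T^{(0)} → T^{(K)}_1` — the measure-level counterpart of the push-forward reading `Setup.IsRT` of the renormalization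
transformations, WITHOUT the series' operation `R` (so its density, when it has one, is the TRUE push-forward density
of the cell's node O3a, not an effective density `ρ_k`).  Mathlib's `Measure.map` returns `0` for a non-measurable map;
under `FiniteEpsData.AvgMeasurable` it is a probability measure (`isProbabilityMeasure_topLaw`). [folklore] -/
noncomputable def topLaw (K : ℕ) : Measure (GaugeField (F.P K) K G) :=
  (gibbsMeasure (F.P K) ((g₀ K)⁻¹ ^ 2)).map (Averaging.iter (D.av K) K)

/-- THE LAW OF `V_K` TRANSPORTED TO `X` (along `cfgEquiv K`). [folklore] -/
noncomputable def unitLaw (K : ℕ) : Measure (UCfg F G) := (topLaw D g₀ K).map (cfgEquiv F G K)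

/-- Under `AvgMeasurable` the law of `V_K` is a probability measure. [folklore] -/
theorem isProbabilityMeasure_topLaw (hA : D.AvgMeasurable) (K : ℕ) : IsProbabilityMeasure (topLaw D g₀ K) := by
  haveI := isProbabilityMeasure_gibbsMeasure (G := G) (F.P K) (sq_nonneg (g₀ K)⁻¹)
  exact Measure.isProbabilityMeasure_map (measurable_iter (D.av K) (hA K) K).aemeasurable

/-- Under `AvgMeasurable` the transported law is a probability measure. [folklore] -/
theorem isProbabilityMeasure_unitLaw (hA : D.AvgMeasurable) (K : ℕ) : IsProbabilityMeasure (unitLaw D g₀ K) := by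
  haveI := isProbabilityMeasure_topLaw D g₀ hA K
  exact Measure.isProbabilityMeasure_map (cfgEquiv F G K).measurable.aemeasurable

/-- The transported laws as a sequence in Mathlib's `ProbabilityMeasure X` (topology of weak convergence). [folklore] -/
noncomputable def unitLawP (hA : D.AvgMeasurable) (K : ℕ) : ProbabilityMeasure (UCfg F G) :=
  ⟨unitLaw D g₀ K, isProbabilityMeasure_unitLaw D g₀ hA K⟩

/-- The underlying measure of `unitLawP K` is `unitLaw K`. [folklore] -/
@[simp] theorem coe_unitLawP (hA : D.AvgMeasurable) (K : ℕ) :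
    ((unitLawP D g₀ hA K : ProbabilityMeasure (UCfg F G)) : Measure (UCfg F G)) = unitLaw D g₀ K := rfl

/-- **THE DICTIONARY**: the finite-ε joint expectation of a string of labels at step `K` is the integral of the FIXED
function `unitObsProd Cs` on `X` against the transported law of `V_K`:
`(D.scheme g₀).expectAt K Cs = ∫ unitObsProd Cs d(unitLaw D g₀ K)`. [folklore] -/
theorem expectAt_eq_integral_unitLaw (hA : D.AvgMeasurable) (K : ℕ) (Cs : List (ULoop F)) :
    (D.scheme g₀).expectAt K Cs = ∫ W, unitObsProd F G Cs W ∂(unitLaw D g₀ K) := by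
  have hmeas : Measurable fun V : GaugeField (F.P K) K G => unitObsProd F G Cs (cfgEquiv F G K V) :=
    (measurable_unitObsProd F G Cs).comp (cfgEquiv F G K).measurable
  rw [unitLaw, integral_map_equiv, topLaw,
    integral_map (measurable_iter (D.av K) (hA K) K).aemeasurable hmeas.aestronglyMeasurable,
    integral_gibbsMeasure_eq_expect (F.P K) (sq_nonneg (g₀ K)⁻¹), scheme_expectAt]
  congr 1
  funext U
  simp only [unitObsProd, avgObs_eq_unitObs]

/-- In particular every transported law integrates `unitObsProd Cs` to a number of modulus `≤ 1`. [folklore] -/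
theorem abs_integral_unitObsProd_unitLaw_le_one (hA : D.AvgMeasurable) (K : ℕ) (Cs : List (ULoop F)) :
    |∫ W, unitObsProd F G Cs W ∂(unitLaw D g₀ K)| ≤ 1 := by
  haveI := isProbabilityMeasure_unitLaw D g₀ hA K
  calc |∫ W, unitObsProd F G Cs W ∂(unitLaw D g₀ K)| ≤ ∫ W, |unitObsProd F G Cs W| ∂(unitLaw D g₀ K) :=
        abs_integral_le_integral_abs
    _ ≤ ∫ _, (1 : ℝ) ∂(unitLaw D g₀ K) := by
        refine integral_mono_of_nonneg (Eventually.of_forall fun _ => abs_nonneg _) (integrable_const 1)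
          (Eventually.of_forall fun W => abs_unitObsProd_le_one F G Cs W)
    _ = 1 := by simp

variable [TopologicalSpace G] [CompactSpace G] [T2Space G] [SecondCountableTopology G] [BorelSpace G]
  [ContinuousMul G] [ContinuousInv G]

omit [ContinuousMul G] [ContinuousInv G] in
/-- WEAK LIMIT POINTS OF THE LAWS EXIST along subsequences (compact metrisable `X`; Prokhorov / Riesz–Markov through
`T4LimitDensity.exists_subseq_tendsto_of_compactSpace`) — the measure-level form of "at least through a compactness
argument using a subsequence of approximations" (MRS pp. 325–326). [folklore] -/
theorem exists_subseq_tendsto_unitLawP (hA : D.AvgMeasurable) :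
    ∃ μ : ProbabilityMeasure (UCfg F G), ∃ φ : ℕ → ℕ, StrictMono φ ∧
      Tendsto (unitLawP D g₀ hA ∘ φ) atTop (𝓝 μ) :=
  exists_subseq_tendsto_of_compactSpace _

omit [T2Space G] in
/-- **EVERY WEAK LIMIT POINT OF THE LAWS IS A LIMIT FUNCTIONAL OF THE CLASS**: if `unitLaw (φ n) → μ` weakly, then along
`φ` the scheme's joint expectations of every string `Cs` converge to `∫ unitObsProd Cs dμ` — the tree's
`Missing.IsLimitFunctional` for the subsequence, represented by the measure `μ` on `X` (continuity of `Re tr` and of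
the group operations makes `unitObsProd Cs` a bounded continuous test function). [folklore] -/
theorem isLimitFunctional_of_tendsto_unitLaw (hA : D.AvgMeasurable) (hc : Continuous (reTr : G → ℝ))
    {μ : ProbabilityMeasure (UCfg F G)} {φ : ℕ → ℕ} (hlim : Tendsto (unitLawP D g₀ hA ∘ φ) atTop (𝓝 μ)) :
    IsLimitFunctional (fun n => (D.scheme g₀).expectAt (φ n))
      (fun Cs => ∫ W, unitObsProd F G Cs W ∂(μ : Measure (UCfg F G))) := by
  intro Cs
  rw [ProbabilityMeasure.tendsto_iff_forall_integral_tendsto] at hlim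
  have h := hlim (BoundedContinuousFunction.mkOfCompact ⟨unitObsProd F G Cs, continuous_unitObsProd F G hc Cs⟩)
  simp only [Function.comp_apply, BoundedContinuousFunction.mkOfCompact_apply, ContinuousMap.coe_mk,
    coe_unitLawP] at h
  simpa only [expectAt_eq_integral_unitLaw D g₀ hA] using h

/-- Cross-check with node E1 (tree `T4Continuum.avg_hasSubseqContinuumLimit`, there hypothesis-free): subsequential
continuum limits of all joint expectations exist — here re-derived from weak compactness of the laws. [folklore] -/
theorem hasSubseqContinuumLimit_of_laws (hA : D.AvgMeasurable) (hc : Continuous (reTr : G → ℝ)) :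
    HasSubseqContinuumLimit (D.scheme g₀) := by
  obtain ⟨μ, φ, hφ, hlim⟩ := exists_subseq_tendsto_unitLawP D g₀ hA
  exact ⟨φ, hφ, fun Cs => ⟨_, isLimitFunctional_of_tendsto_unitLaw D g₀ hA hc hlim Cs⟩⟩

end Laws

/-! ## 3. Node E4 for `FiniteEpsData`: the hypotheses on `X`, their levelwise readings, the instantiated conclusions -/

section E4

variable {F : T4Family} {G : Type*} [GaugeGroup G] [MeasurableSpace G] [HaarData G] [RegularGaugeGroup G]
  (D : FiniteEpsData F G) (g₀ : ℕ → ℝ)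

/-- NAMED HYPOTHESIS `E4UpperT4` = `T4LimitDensity.E4Upper` FOR THE FOUR-TORUS DATA (NOT a printed statement, NOT
asserted): the transported laws of the averaged fields are dominated uniformly in `K` by a multiple of product Haar
measure on `X`, `∃ E, ∀ K, unitLaw D g₀ K ≤ e^{E} · unitHaar`; equivalently (`e4UpperT4_iff`) `topLaw D g₀ K ≤ e^{E} dV`
on each `T^{(K)}_1`.  Located at the UPPER half of [Balaban1988Convergent] (2.50) p. 264 READ FOR THE PUSH-FORWARD
LAWS (the printed bound is for the effective densities `ρ_k`; cell T4-DAG §2 O3a / O3-alt, §7 Q6). [cite: Balaban1988Convergent, (2.50) p.264 (upper half)] -/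
def E4UpperT4 : Prop := E4Upper (unitHaar F G) (unitLaw D g₀)

/-- NAMED HYPOTHESIS `E4LowerT4` = `T4LimitDensity.E4Lower` for the four-torus data (NOT a printed statement, NOT
asserted): `∃ E, ∀ K, e^{-E} · unitHaar ≤ unitLaw D g₀ K`; STRONGER IN SHAPE than the printed, V-dependent lower half
of (2.50), whose derivation is moreover not printed in d = 4 (cell GAPS.md G-adv3-2). [cite: Balaban1988Convergent, (2.50) p.264 (lower half)] -/
def E4LowerT4 : Prop := E4Lower (unitHaar F G) (unitLaw D g₀)

/-- NAMED HYPOTHESIS `E4HypT4 := E4LowerT4 ∧ E4UpperT4` (= `T4LimitDensity.E4Hyp` for the four-torus data; the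
two-sided READING of (2.50) for the laws, NOT a printed statement, NOT asserted). [cite: Balaban1988Convergent, (2.50) p.264] -/
def E4HypT4 : Prop := E4Hyp (unitHaar F G) (unitLaw D g₀)

omit [RegularGaugeGroup G] in
/-- `E4HypT4` is the conjunction of the two one-sided hypotheses (definitionally). [folklore] -/
theorem e4HypT4_iff : E4HypT4 D g₀ ↔ E4LowerT4 D g₀ ∧ E4UpperT4 D g₀ := Iff.rfl

omit [RegularGaugeGroup G] in
/-- Transport of an upper bound: `unitLaw K ≤ c · unitHaar` on `X` iff `topLaw K ≤ c · dV` on `T^{(K)}_1`. [folklore] -/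
theorem unitLaw_le_smul_iff (K : ℕ) (c : ℝ≥0∞) :
    unitLaw D g₀ K ≤ c • unitHaar F G ↔ topLaw D g₀ K ≤ c • fieldMeasure (F.P K) K G := by
  rw [← map_fieldMeasure_cfgEquiv F G K, ← Measure.map_smul, unitLaw, map_le_map_iff]

omit [RegularGaugeGroup G] in
/-- Transport of a lower bound: `c · unitHaar ≤ unitLaw K` on `X` iff `c · dV ≤ topLaw K` on `T^{(K)}_1`. [folklore] -/
theorem smul_le_unitLaw_iff (K : ℕ) (c : ℝ≥0∞) :
    c • unitHaar F G ≤ unitLaw D g₀ K ↔ c • fieldMeasure (F.P K) K G ≤ topLaw D g₀ K := by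
  rw [← map_fieldMeasure_cfgEquiv F G K, ← Measure.map_smul, unitLaw, map_le_map_iff]

omit [RegularGaugeGroup G] in
/-- LEVELWISE READING of `E4UpperT4`: a `K`-uniform bound `law(V_K) ≤ e^{E} dV` on the unit lattices themselves. [folklore] -/
theorem e4UpperT4_iff : E4UpperT4 D g₀ ↔
    ∃ E : ℝ, ∀ K, topLaw D g₀ K ≤ ENNReal.ofReal (Real.exp E) • fieldMeasure (F.P K) K G := by
  simp only [E4UpperT4, E4Upper, unitLaw_le_smul_iff]

omit [RegularGaugeGroup G] in
/-- LEVELWISE READING of `E4LowerT4`. [folklore] -/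
theorem e4LowerT4_iff : E4LowerT4 D g₀ ↔
    ∃ E : ℝ, ∀ K, ENNReal.ofReal (Real.exp (-E)) • fieldMeasure (F.P K) K G ≤ topLaw D g₀ K := by
  simp only [E4LowerT4, E4Lower, smul_le_unitLaw_iff]

omit [RegularGaugeGroup G] in
/-- How the levelwise bound would be supplied from a DENSITY (the shape of the cell's node O3a: a bound on the true
push-forward density): if `topLaw K` has a density `ρ'` w.r.t. `dV` with `ρ' ≤ e^{E}` a.e., then `topLaw K ≤ e^{E} dV`.
Nothing here asserts that such a bound holds. [folklore] -/
theorem topLaw_le_of_density_le {K : ℕ} {ρ' : GaugeField (F.P K) K G → ℝ≥0∞}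
    (hρ : topLaw D g₀ K = (fieldMeasure (F.P K) K G).withDensity ρ') {E : ℝ}
    (hle : ∀ᵐ V ∂fieldMeasure (F.P K) K G, ρ' V ≤ ENNReal.ofReal (Real.exp E)) :
    topLaw D g₀ K ≤ ENNReal.ofReal (Real.exp E) • fieldMeasure (F.P K) K G := by
  rw [hρ]
  exact (withDensity_mono hle).trans_eq (withDensity_const _)

variable [TopologicalSpace G] [CompactSpace G] [T2Space G] [SecondCountableTopology G] [BorelSpace G]

/-- **E4a FOR THE FOUR-TORUS DATA** (instantiated `E4Upper.limit_le`): under `E4UpperT4`, every weak limit point `μ` of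
the transported laws along a subsequence satisfies `μ ≤ e^{E} · unitHaar`, hence `μ ≪ unitHaar` (product-Haar absolute
continuity of the limit) and `dμ/d unitHaar ≤ e^{E}` a.e. [folklore] -/
theorem limit_le_of_e4UpperT4 (hA : D.AvgMeasurable) (hU : E4UpperT4 D g₀) {μ : ProbabilityMeasure (UCfg F G)}
    {φ : ℕ → ℕ} (hlim : Tendsto (unitLawP D g₀ hA ∘ φ) atTop (𝓝 μ)) :
    ∃ E : ℝ, (μ : Measure (UCfg F G)) ≤ ENNReal.ofReal (Real.exp E) • unitHaar F G ∧
      (μ : Measure (UCfg F G)) ≪ unitHaar F G ∧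
      ((μ : Measure (UCfg F G)).rnDeriv (unitHaar F G) ≤ᵐ[unitHaar F G] fun _ => ENNReal.ofReal (Real.exp E)) := by
  rw [ProbabilityMeasure.tendsto_iff_forall_lintegral_tendsto] at hlim
  exact E4Upper.limit_le hU (fun f => by simpa using hlim f)

/-- **E4b FOR THE FOUR-TORUS DATA** (instantiated `E4Lower.le_limit`): under `E4LowerT4`, every weak limit point `μ`
satisfies `e^{-E} · unitHaar ≤ μ`, hence `unitHaar ≪ μ` and, where `μ ≪ unitHaar`, `e^{-E} ≤ dμ/d unitHaar` a.e. [folklore] -/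
theorem le_limit_of_e4LowerT4 (hA : D.AvgMeasurable) (hL : E4LowerT4 D g₀) {μ : ProbabilityMeasure (UCfg F G)}
    {φ : ℕ → ℕ} (hlim : Tendsto (unitLawP D g₀ hA ∘ φ) atTop (𝓝 μ)) :
    ∃ E : ℝ, ENNReal.ofReal (Real.exp (-E)) • unitHaar F G ≤ (μ : Measure (UCfg F G)) ∧
      unitHaar F G ≪ (μ : Measure (UCfg F G)) ∧
      ((μ : Measure (UCfg F G)) ≪ unitHaar F G →
        (fun _ => ENNReal.ofReal (Real.exp (-E))) ≤ᵐ[unitHaar F G] (μ : Measure (UCfg F G)).rnDeriv (unitHaar F G)) := by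
  rw [ProbabilityMeasure.tendsto_iff_forall_lintegral_tendsto] at hlim
  exact E4Lower.le_limit hL (fun f => by simpa using hlim f)

/-- **TWO-SIDED, FOR THE FOUR-TORUS DATA** (instantiated `E4Hyp.exists_limit`): under `E4HypT4` there is a subsequence
along which the transported laws converge weakly to a probability measure EQUIVALENT to product Haar measure, with the
two-sided window `e^{-E} unitHaar ≤ μ ≤ e^{E} unitHaar` (by `limit_le_of_e4UpperT4` / `le_limit_of_e4LowerT4` the same
holds for every weak limit point).  Which limit point — uniqueness — is untouched. [folklore] -/
theorem exists_haarEquivalent_limit_of_e4HypT4 (hA : D.AvgMeasurable) (h : E4HypT4 D g₀) :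
    ∃ μ : ProbabilityMeasure (UCfg F G), ∃ φ : ℕ → ℕ, StrictMono φ ∧
      Tendsto (unitLawP D g₀ hA ∘ φ) atTop (𝓝 μ) ∧
      ∃ E : ℝ, (ENNReal.ofReal (Real.exp (-E)) • unitHaar F G ≤ (μ : Measure (UCfg F G)) ∧
        (μ : Measure (UCfg F G)) ≤ ENNReal.ofReal (Real.exp E) • unitHaar F G) ∧
        ((μ : Measure (UCfg F G)) ≪ unitHaar F G ∧ unitHaar F G ≪ (μ : Measure (UCfg F G))) :=
  E4Hyp.exists_limit (law := unitLawP D g₀ hA) h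

variable [ContinuousMul G] [ContinuousInv G]

/-- **E4a, CLASS FORM**: under `E4UpperT4` (and continuity of `Re tr`) the class has a subsequential limit functional
represented by a probability measure on `X` that is ABSOLUTELY CONTINUOUS w.r.t. product Haar with density `≤ e^{E}`. [folklore] -/
theorem exists_limitFunctional_ac_of_e4UpperT4 (hA : D.AvgMeasurable) (hc : Continuous (reTr : G → ℝ))
    (hU : E4UpperT4 D g₀) :
    ∃ μ : ProbabilityMeasure (UCfg F G), ∃ φ : ℕ → ℕ, StrictMono φ ∧
      IsLimitFunctional (fun n => (D.scheme g₀).expectAt (φ n))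
        (fun Cs => ∫ W, unitObsProd F G Cs W ∂(μ : Measure (UCfg F G))) ∧
      (μ : Measure (UCfg F G)) ≪ unitHaar F G ∧
      ∃ E : ℝ, (μ : Measure (UCfg F G)) ≤ ENNReal.ofReal (Real.exp E) • unitHaar F G ∧
        ((μ : Measure (UCfg F G)).rnDeriv (unitHaar F G) ≤ᵐ[unitHaar F G] fun _ => ENNReal.ofReal (Real.exp E)) := by
  obtain ⟨μ, φ, hφ, hlim⟩ := exists_subseq_tendsto_unitLawP D g₀ hA
  obtain ⟨E, hle, hac, hrn⟩ := limit_le_of_e4UpperT4 D g₀ hA hU hlim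
  exact ⟨μ, φ, hφ, isLimitFunctional_of_tendsto_unitLaw D g₀ hA hc hlim, hac, E, hle, hrn⟩

/-- **TWO-SIDED, CLASS FORM**: under `E4HypT4` (and continuity of `Re tr`) the class has a subsequential limit functional
represented by a probability measure on `X` EQUIVALENT to product Haar, with the two-sided window. [folklore] -/
theorem exists_limitFunctional_of_e4HypT4 (hA : D.AvgMeasurable) (hc : Continuous (reTr : G → ℝ))
    (h : E4HypT4 D g₀) :
    ∃ μ : ProbabilityMeasure (UCfg F G), ∃ φ : ℕ → ℕ, StrictMono φ ∧
      IsLimitFunctional (fun n => (D.scheme g₀).expectAt (φ n))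
        (fun Cs => ∫ W, unitObsProd F G Cs W ∂(μ : Measure (UCfg F G))) ∧
      ((μ : Measure (UCfg F G)) ≪ unitHaar F G ∧ unitHaar F G ≪ (μ : Measure (UCfg F G))) ∧
      ∃ E : ℝ, ENNReal.ofReal (Real.exp (-E)) • unitHaar F G ≤ (μ : Measure (UCfg F G)) ∧
        (μ : Measure (UCfg F G)) ≤ ENNReal.ofReal (Real.exp E) • unitHaar F G := by
  obtain ⟨μ, φ, hφ, hlim, E, hw, hac⟩ := exists_haarEquivalent_limit_of_e4HypT4 D g₀ hA h
  exact ⟨μ, φ, hφ, isLimitFunctional_of_tendsto_unitLaw D g₀ hA hc hlim, hac, E, hw⟩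

end E4

/-! ## 4. Sanity: the instance hypotheses for `G = SU(N)` -/

section SU

open Literature.MathematicalPhysics.QuantumLattice

/-- For `G = SU(N)` with the tree's `UnitaryModel` instances, every instance hypothesis of §§2–3 is available (second
countability through the embedding into `M_N(ℂ)`, as in `UnitaryModel`) and `Re tr = Re Tr/N` is continuous. [folklore] -/
example {N : ℕ} [NeZero N] :
    (CompactSpace (Matrix.specialUnitaryGroup (Fin N) ℂ) ∧ T2Space (Matrix.specialUnitaryGroup (Fin N) ℂ) ∧
      SecondCountableTopology (Matrix.specialUnitaryGroup (Fin N) ℂ) ∧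
      BorelSpace (Matrix.specialUnitaryGroup (Fin N) ℂ) ∧ ContinuousMul (Matrix.specialUnitaryGroup (Fin N) ℂ) ∧
      ContinuousInv (Matrix.specialUnitaryGroup (Fin N) ℂ) ∧
      RegularGaugeGroup (Matrix.specialUnitaryGroup (Fin N) ℂ)) ∧
    Continuous (reTr : Matrix.specialUnitaryGroup (Fin N) ℂ → ℝ) := by
  haveI := secondCountableTopology_matrix (n := Fin N)
  haveI : SecondCountableTopology (Matrix.specialUnitaryGroup (Fin N) ℂ) :=
    Topology.IsEmbedding.subtypeVal.secondCountableTopology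
  exact ⟨⟨inferInstance, inferInstance, inferInstance, inferInstance, inferInstance, inferInstance, inferInstance⟩,
    UnitaryModel.continuous_nReTr.comp (continuous_fundamentalRep (Fin N))⟩

end SU

end Literature.MathematicalPhysics.QuantumFieldTheory.Balaban1983to89.T4LimitDensityT4
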